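import Literature.Topology.CoveringSpaces.CoveringGaloisCorrespondenceEquivalence
import Literature.Topology.CoveringSpaces.CoveringMonodromyStabilizer
import Literature.AnabelianGeometry.Anabelioids.ConnectedOfEquivalence
import Mathlib.CategoryTheory.Galois.Examples
import HarnessLib

/-!
# Connected objects of `Cov^fin(X)` are the covering spaces with path-connected total space

PROOF-ONLY companion (abc-iut cell, campaign-L R1 support, GAP row G-L4t14-R1; seat abc-iut-f-072): the
first entry of the dictionary «Galois category `Cov^fin(X)` ↔ topology» ([SGA1] Exp. V §4–§5: connected
objects = transitive fibre; Hatcher Prop. 1.32: transitive monodromy ⟺ path-connected total space).  For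
`X` path connected and strongly locally contractible, `x₀ ∈ X`, and a finite covering space `E ∈ Cov^fin(X)`:

* `CovFin.isConnected_iff_isPretransitive` — `E` is a CONNECTED object (Mathlib
  `PreGaloisCategory.IsConnected`: non-initial, no non-trivial subobject) iff `π₁(X, x₀)` acts transitively
  on the fibre `p⁻¹(x₀)` (Mathlib `FintypeCat.Action.isConnected_iff_transitive` through abc-iut-w5-d144's
  `CovFin.galoisCorrespondence`, connectedness being invariant under equivalence);
* `CovFin.isConnected_iff_pathConnectedSpace` — iff the total space of `E` is PATH CONNECTED (abc-iut-L6-t18's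
  `CoverMonodromy.pathConnectedSpace_iff_isPretransitive`); the empty cover is initial, hence not connected.

Theorems only; nothing here bears on [IUTchIII] Cor. 3.12.
-/

noncomputable section

open CategoryTheory CategoryTheory.Limits CategoryTheory.PreGaloisCategory

universe u

namespace Literature.Topology.CoveringSpaces.CovFin

open Literature.AnabelianGeometry.Anabelioids

variable {X : Type u} [TopologicalSpace X] [PathConnectedSpace X] [StronglyLocallyContractibleSpace X]

/-- **Connected objects of `Cov^fin(X)` = covers with transitive monodromy on `p⁻¹(x₀)`** (for a
non-empty fibre). [cite: SGA1, Exp. V §5] -/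
theorem isConnected_iff_isPretransitive (x₀ : X) (E : CovFin X) [Nonempty (E.proj ⁻¹' {x₀})] :
    IsConnected E ↔
      letI := E.property.1.fundamentalGroupMulAction x₀
      MulAction.IsPretransitive (FundamentalGroup X x₀) (E.proj ⁻¹' {x₀}) := by
  rw [isConnected_iff_of_equivalence (galoisCorrespondence (X := X) x₀) E]
  haveI : Nonempty ((fibreFunctor x₀).obj E).V := ‹Nonempty (E.proj ⁻¹' {x₀})›
  exact FintypeCat.Action.isConnected_iff_transitive (FundamentalGroup X x₀) ((fibreFunctor x₀).obj E)

omit [StronglyLocallyContractibleSpace X] in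
/-- The fibre over any point of a cover with non-empty total space is non-empty (path-connected base:
transport a point along a lifted path). [cite: HatcherAT2002, Prop. 1.30] -/
theorem nonempty_fibre (x₀ : X) (E : CovFin X) [h : Nonempty E.obj.left] : Nonempty (E.proj ⁻¹' {x₀}) := by
  obtain ⟨z⟩ := h
  exact ⟨E.property.1.monodromy
    (Path.Homotopic.Quotient.mk (PathConnectedSpace.somePath (E.proj z) x₀)) ⟨z, rfl⟩⟩

omit [PathConnectedSpace X] [StronglyLocallyContractibleSpace X] in
/-- The empty cover is an initial object of `Cov^fin(X)`. [cite: SGA1, Exp. V §4 (condition (G1))] -/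
theorem isInitial_of_isEmpty (E : CovFin X) [IsEmpty E.obj.left] : Nonempty (IsInitial E) :=
  ⟨IsInitial.ofUniqueHom
    (fun _ => homMk (fun e => isEmptyElim e) continuous_of_discreteTopology (fun e => isEmptyElim e))
    (fun _ _ => hom_ext (funext fun e => isEmptyElim e))⟩

/-- **Connected objects of `Cov^fin(X)` = covering spaces with PATH-CONNECTED total space.**
[cite: SGA1, Exp. V §5] -/
theorem isConnected_iff_pathConnectedSpace (x₀ : X) (E : CovFin X) :
    IsConnected E ↔ PathConnectedSpace E.obj.left := by
  rcases isEmpty_or_nonempty E.obj.left with hE | hE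
  · -- empty total space: initial, not connected; not path connected
    obtain ⟨hI⟩ := isInitial_of_isEmpty E
    exact ⟨fun h => (h.notInitial hI).elim, fun h => (IsEmpty.false (h.nonempty.some)).elim⟩
  · haveI := nonempty_fibre x₀ E
    rw [isConnected_iff_isPretransitive x₀ E,
      CoverMonodromy.pathConnectedSpace_iff_isPretransitive E.property.1 x₀]

end Literature.Topology.CoveringSpaces.CovFin
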